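import Mathlib.AlgebraicGeometry.Group.Abelian
import Literature.AlgebraicGeometry.Motives.AbelianVariety
import HarnessLib

/-!
# The rigidity theorem and its corollaries (Milne, *Abelian Varieties*, §2)

Milne, *Abelian Varieties* (Ch. V of Cornell–Silverman, *Arithmetic Geometry*, 1986), §2, and
Mumford, *Abelian Varieties*, §4:

* `rigidity_of_isAlgClosed`, `rigidity` — the **rigidity theorem** (Milne Thm. 2.1; Mumford §4)
  in Mumford's form: `V` complete, `W` (geometrically) integral of finite type, `U`
  separated of finite type over `k`, `φ : W × V → U` constant on the fibre `{w₀} × V` of a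
  rational point; then `φ(w, v) = φ(w, v₀)`, i.e. `φ` factors through the projection onto `W`.
  Over `k = k̄` the proof is Mathlib's argument for
  `AlgebraicGeometry.isCommMonObj_of_isProper_of_isIntegral_tensorObj_of_isAlgClosed` (which is
  the special case `φ = ` commutator of a proper group scheme) run for a general target: by
  Zariski's main theorem (`exists_finite_imageι_comp_morphismRestrict_of_finite_image_preimage`)
  the graph-type map `(w, v) ↦ (w, φ(w, v))` has finite image over an open `w₀ ∈ U' ⊆ W`; the
  fibres `{w} × V` are irreducible, so `φ` is constant on them for closed `w ∈ U'`; closed points of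
  the dense open `U' × V` suffice (`ext_of_apply_eq`). Over a general `k` one descends along the
  faithfully flat `Spec k̄ → Spec k` (`Over.pullback` is faithful and cartesian-monoidal);
  `rigidity_const` is the statement as printed by Milne (`φ` constant on `{w₀} × V` and on
  `W × {v₀}` ⇒ `φ` constant).
* `eq_mul_of_point_comp_eq_one` — **Milne Cor. 2.5**: a morphism `h : V × W → A` into an abelian
  variety with `h(v₀, w₀) = 0` is `h(v, w) = h(v, w₀) + h(v₀, w)`.
* `isMonHom_of_one_comp` — **Milne Cor. 2.2** / Remark 2.3: a `k`-morphism of abelian varieties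
  preserving the origin is a homomorphism.

Group laws on `Hom_k(T, A)` are written multiplicatively, as in Mathlib's `Hom.commGroup`
(`Mathlib/CategoryTheory/Monoidal/Cartesian/Grp_.lean`); rational points are morphisms
`𝟙_ (Over (Spec k)) ⟶ X`.

Mathlib has the commutativity of abelian varieties
(`isCommMonObj_of_isProper_of_geometricallyIntegral`, Stacks 0BFD) but no stand-alone rigidity
lemma (searched `rigidity`, `Rigidity` in `Mathlib/AlgebraicGeometry`: no hits); the two
`set_option backward.*` lines below are the ones Mathlib uses for the same argument in
`Mathlib/AlgebraicGeometry/Group/Abelian.lean`.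

## References

* J. S. Milne, *Abelian Varieties*, Ch. V of Cornell–Silverman (eds.), *Arithmetic Geometry*,
  Springer 1986: §1 (conventions), Thm. 2.1, Cor. 2.2, Remark 2.3, Cor. 2.5 (pp. 104–105).
  [Milne1986AbelianVarieties]
* D. Mumford, *Abelian Varieties*, §4 (Rigidity lemma and its Cor. 1). [MumfordAV1970]
* The Stacks project, Tag 0BFD.
-/

noncomputable section

open CategoryTheory Limits AlgebraicGeometry MonoidalCategory CartesianMonoidalCategory

universe u

namespace Literature.AlgebraicGeometry.Motives

variable {K : Type u} [Field K]

set_option backward.isDefEq.respectTransparency false in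
/-- A `K`-point of a `K`-scheme is a closed immersion. [folklore] -/
theorem isClosedImmersion_left_of_point {W : Over (Spec (.of K))} (w₀ : 𝟙_ _ ⟶ W) :
    IsClosedImmersion w₀.left :=
  isClosedImmersion_of_comp_eq_id (Y := Spec (.of K)) W.hom w₀.left (by simp)

/-- `(w₀, v) = (snd ≫ (v ↦ (w₀, v)))` on `𝟙 ⊗ V`. [folklore] -/
theorem whiskerRight_point_eq {W V : Over (Spec (.of K))} (w₀ : 𝟙_ _ ⟶ W) :
    w₀ ▷ V = snd _ _ ≫ lift (toUnit V ≫ w₀) (𝟙 V) := by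
  have h : fst (𝟙_ (Over (Spec (.of K)))) V = snd _ _ ≫ toUnit V := toUnit_unique _ _
  ext
  · rw [whiskerRight_fst, Category.assoc, lift_fst, h, Category.assoc]
  · simp

set_option backward.defeqAttrib.useBackward true in
set_option backward.isDefEq.respectTransparency false in
/-- **Rigidity theorem** over an algebraically closed field (Milne, *Abelian Varieties*, Thm. 2.1;
Mumford, *Abelian Varieties*, §4, Rigidity lemma), in Mumford's form: let `V` be complete, `W ⊗ V`
integral, `U` separated of finite type, and `φ : W × V → U` a morphism which is constant on the
fibre `{w₀} × V` of a rational point `w₀`; then `φ(w, v) = φ(w, v₀)` for any rational point `v₀` of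
`V`, i.e. `φ` factors through the projection to `W`. The proof is Mathlib's argument for
`isCommMonObj_of_isProper_of_isIntegral_tensorObj_of_isAlgClosed` (Zariski's main theorem in the
form `exists_finite_imageι_comp_morphismRestrict_of_finite_image_preimage`, then irreducibility of
the fibres `{w} × V` and density of closed points), run for a general target.
[cite: Milne1986AbelianVarieties, §2 Thm. 2.1 (Rigidity Theorem)] -/
theorem rigidity_of_isAlgClosed [IsAlgClosed K] {W V U : Over (Spec (.of K))}
    [IsProper V.hom] [LocallyOfFiniteType W.hom] [IsIntegral (W ⊗ V).left]
    [IsSeparated U.hom] [LocallyOfFiniteType U.hom]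
    (φ : W ⊗ V ⟶ U) (w₀ : 𝟙_ _ ⟶ W) (v₀ : 𝟙_ _ ⟶ V) (u₀ : 𝟙_ _ ⟶ U)
    (hφ : lift (toUnit V ≫ w₀) (𝟙 V) ≫ φ = toUnit V ≫ u₀) :
    φ = lift (fst W V) (toUnit _ ≫ v₀) ≫ φ := by
  let S := Spec (.of K)
  let point : S := IsLocalRing.closedPoint K
  have hpoint : IsClosed {point} := isClosed_discrete _
  have : Nonempty V.left := ⟨v₀.left point⟩
  have : Nonempty W.left := ⟨w₀.left point⟩
  have : LocallyOfFiniteType (W ⊗ V).hom := by dsimp; infer_instance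
  have : JacobsonSpace (W ⊗ V).left := LocallyOfFiniteType.jacobsonSpace (Y := Spec _) (W ⊗ V).hom
  have : Surjective V.hom := ⟨Function.surjective_to_subsingleton (α := V.left) (β := Spec _) _⟩
  have : IsProper (fst W V).left := by dsimp; infer_instance
  have : Surjective (fst W V).left := by dsimp; infer_instance
  have : IsSeparated (fst W U).left := by dsimp; infer_instance
  have : LocallyOfFiniteType (fst W U).left := by dsimp; infer_instance
  have : LocallyOfFiniteType (φ.left ≫ U.hom) := by rw [Over.w]; infer_instance
  have : IsClosedImmersion w₀.left := isClosedImmersion_left_of_point w₀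
  have : IsClosedImmersion ((lift w₀ u₀).left ≫ (fst W U).left) := by
    simpa using (inferInstanceAs (IsClosedImmersion w₀.left))
  have : IsClosedImmersion (lift w₀ u₀).left := .of_comp _ (g := (fst W U).left)
  have hφ' : w₀ ▷ V ≫ φ = toUnit _ ≫ u₀ := by
    rw [whiskerRight_point_eq, Category.assoc, hφ, ← Category.assoc]
    congr 1
    exact toUnit_unique _ _
  let γ : W ⊗ V ⟶ W ⊗ U := lift (fst _ _) φ
  have : IsProper (γ.left ≫ (fst W U).left) := by simpa [γ]
  have : IsProper γ.left := .of_comp _ (fst W U).left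
  ext1
  have H : γ.left '' ((fst W V).left ⁻¹' {w₀.left point}) ⊆ {(lift w₀ u₀).left point} := by
    rw [Set.image_subset_iff, ← Set.sdiff_eq_empty, ← Set.not_nonempty_iff_eq_empty]
    intro H
    obtain ⟨c₀, ⟨hc₁, hc₂⟩, hc₃⟩ := nonempty_inter_closedPoints H <| by
      rw [Set.sdiff_eq_compl_inter, ← Set.image_singleton, ← Set.image_singleton]
      refine (IsOpen.isLocallyClosed ?_).inter (IsClosed.isLocallyClosed ?_)
      · exact (((lift w₀ u₀).left.isClosedMap _ hpoint).preimage γ.left.continuous).isOpen_compl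
      · exact (w₀.left.isClosedMap _ hpoint).preimage (fst W V).left.continuous
    obtain ⟨⟨c, hc⟩, e⟩ := (pointEquivClosedPoint (W ⊗ V).hom).surjective ⟨c₀, hc₃⟩
    obtain rfl : c point = c₀ := congr(($e).1)
    let fc : 𝟙_ (Over S) ⟶ 𝟙_ (Over S) ⊗ V := lift (𝟙 _) (Over.homMk c hc ≫ snd W V)
    have : c ≫ pullback.fst W.hom V.hom = w₀.left :=
      ext_of_apply_closedPoint_eq W.hom (by simpa using hc) (by simp) (by simpa using hc₁)
    have H₁ : c = fc.left ≫ (w₀ ▷ V).left := by dsimp; ext <;> simp [fc, S, this]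
    have H₂ : fc ≫ w₀ ▷ V ≫ γ = lift w₀ u₀ := by
      ext1
      · simp [fc, γ, S]
      · simp only [γ, Category.assoc, lift_snd, hφ']
        rw [← Category.assoc]
        convert Category.id_comp u₀
        exact toUnit_unique _ _
    exact hc₂ <| by simp [H₁, H₂, ← Scheme.Hom.comp_apply, Category.assoc, ← Over.comp_left]
  -- By Zariski's main theorem there is an open `w₀ ∈ U' ⊆ W` over which `γ` has finite image.
  obtain ⟨U', hU', H⟩ := exists_finite_imageι_comp_morphismRestrict_of_finite_image_preimage
    γ.left (fst W U).left (w₀.left point) (by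
      dsimp [-Scheme.Hom.comp_base, γ]
      simp only [pullback.lift_fst]
      exact (Set.finite_singleton _).subset H)
  have H (x : U') : ((pullback.fst W.hom U.hom) ⁻¹' {x.1} ∩ Set.range γ.left).Finite := by
    refine ((((γ.left.imageι ≫ (fst W U).left) ∣_ U').finite_preimage_singleton x).image
      (Scheme.Opens.ι _ ≫ γ.left.imageι)).subset ?_
    have : U'.ι ⁻¹' {x.1} = {x} := by ext; simp
    rw [← this, ← Set.preimage_comp, ← TopCat.coe_comp, ← Scheme.Hom.comp_base,
      morphismRestrict_ι, ← Category.assoc, Scheme.Hom.comp_base (_ ≫ _) (fst W U).left,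
      TopCat.coe_comp, Set.preimage_comp, Set.image_preimage_eq_inter_range]
    simp only [Scheme.Hom.comp_base, TopCat.coe_comp, Set.range_comp, Scheme.Opens.range_ι]
    dsimp
    rw [Set.image_preimage_eq_inter_range, Scheme.IdealSheafData.range_subschemeι,
      Scheme.Hom.support_ker, ← Set.inter_assoc, ← Set.preimage_inter,
      Set.singleton_inter_of_mem x.2, IsClosed.closure_eq
      (by exact γ.left.isClosedMap.isClosed_range)]
  -- It suffices to check equality on the closed points of the dense open `U' × V`.
  refine ext_of_apply_eq U.hom _
    ((fst W V).left ⁻¹ᵁ U').isOpen.isLocallyClosed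
    (((fst W V).left ⁻¹ᵁ U').isOpen.dense ?_) ?_ ?_
  · exact .preimage ⟨_, hU'⟩ (fst W V).left.surjective
  · intro y hyU hy
    have hx : IsClosed {(fst W V).left y} := by simpa using (fst W V).left.isClosedMap _ hy
    let x : 𝟙_ _ ⟶ W := Over.homMk (pointOfClosedPoint W.hom _ hx) (by simp)
    let y' : ↥(W ⊗ V).left := (lift (fst W V) (toUnit _ ≫ v₀)).left y
    have : γ.left y = γ.left y' := by
      -- `γ({x} × V)` is finite and `{x} × V` is irreducible, hence `γ` is constant on it.
      refine subsingleton_image_closure_of_finite_of_isPreirreducible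
        (hx.preimage (fst W V).left.continuous).isLocallyClosed ?_ γ.left.continuous
        γ.left.isClosedMap ((H ⟨_, hyU⟩).subset (Set.image_subset_iff.mpr fun _ ↦ by
          simp [← Scheme.Hom.comp_apply, -Scheme.Hom.comp_base, γ])) ?_ ?_
      · let α : W ⊗ V ⟶ W ⊗ V := toUnit _ ≫ x ⊗ₘ 𝟙 _
        convert!
          ((IrreducibleSpace.isIrreducible_univ _).image α.left
              α.left.continuous.continuousOn).isPreirreducible
        rw [Over.tensorHom_left]
        simp [Set.range_comp, Scheme.Pullback.range_map, x]
      · exact ⟨y, subset_closure (by simp), rfl⟩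
      · refine ⟨y', subset_closure ?_, rfl⟩
        simp [y', ← Scheme.Hom.comp_apply, -Scheme.Hom.comp_base]
    convert! congr((snd W U).left $this) using 1
    · simp [γ, ← Scheme.Hom.comp_apply]
    · simp [y', γ, ← Scheme.Hom.comp_apply, -Scheme.Hom.comp_base]
  · simp


/-- A point followed by the map to the terminal object is the identity. [folklore] -/
theorem point_comp_toUnit {V : Over (Spec (.of K))} (v₀ : 𝟙_ _ ⟶ V) : v₀ ≫ toUnit V = 𝟙 _ :=
  toUnit_unique _ _

/-- **Rigidity theorem** over an arbitrary field (Milne, *Abelian Varieties*, Thm. 2.1; Mumford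
§4): `V` complete and geometrically integral, `W` geometrically integral of finite type, `U`
separated of finite type over `k`; if `φ : W × V → U` is constant on `{w₀} × V` for a rational
point `w₀ ∈ W(k)`, then `φ(w, v) = φ(w, v₀)` for every rational point `v₀ ∈ V(k)`. Reduced to the
algebraically closed case `rigidity_of_isAlgClosed` by the faithfully flat base change
`k → k̄` (Mathlib: `Over.pullback` is faithful and monoidal), exactly as Milne deduces statements
over `k` from `k̄` (Ch. V §1: "two morphisms … are equal if they become equal over `k̄`").
[cite: Milne1986AbelianVarieties, §2 Thm. 2.1 (Rigidity Theorem)] -/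
theorem rigidity {W V U : Over (Spec (.of K))}
    [IsProper V.hom] [GeometricallyIntegral V.hom]
    [LocallyOfFiniteType W.hom] [GeometricallyIntegral W.hom]
    [IsSeparated U.hom] [LocallyOfFiniteType U.hom]
    (φ : W ⊗ V ⟶ U) (w₀ : 𝟙_ _ ⟶ W) (v₀ : 𝟙_ _ ⟶ V) (u₀ : 𝟙_ _ ⟶ U)
    (hφ : lift (toUnit V ≫ w₀) (𝟙 V) ≫ φ = toUnit V ≫ u₀) :
    φ = lift (fst W V) (toUnit _ ≫ v₀) ≫ φ := by
  let f := Spec.map (CommRingCat.ofHom <| algebraMap K (AlgebraicClosure K))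
  let P := Over.pullback f
  have : IsIntegral ((P.obj W) ⊗ (P.obj V)).left :=
    inferInstanceAs (IsIntegral (pullback (pullback.snd W.hom f) (pullback.snd V.hom f)))
  have : IsProper (P.obj V).hom := inferInstanceAs (IsProper (pullback.snd V.hom f))
  have : LocallyOfFiniteType (P.obj W).hom :=
    inferInstanceAs (LocallyOfFiniteType (pullback.snd W.hom f))
  have : IsSeparated (P.obj U).hom := inferInstanceAs (IsSeparated (pullback.snd U.hom f))
  have : LocallyOfFiniteType (P.obj U).hom :=
    inferInstanceAs (LocallyOfFiniteType (pullback.snd U.hom f))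
  open Functor.LaxMonoidal Functor.Monoidal in
  have key := rigidity_of_isAlgClosed (μ P W V ≫ P.map φ) (ε P ≫ P.map w₀) (ε P ≫ P.map v₀)
    (ε P ≫ P.map u₀) (by
      have h := P.congr_map hφ
      rw [Functor.map_comp, Functor.map_comp, ← lift_μ, Functor.map_comp, ← toUnit_ε,
        CategoryTheory.Functor.map_id] at h
      simpa only [Category.assoc] using h)
  apply P.map_injective
  open Functor.LaxMonoidal Functor.Monoidal in
  rw [Functor.map_comp, ← lift_μ, Functor.map_comp, ← toUnit_ε, ← cancel_epi (μ P W V)]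
  refine key.trans ?_
  simp only [Category.assoc, comp_lift_assoc, Functor.Monoidal.μ_fst, comp_toUnit_assoc]

/-- **Rigidity theorem, as printed** (Milne, *Abelian Varieties*, Thm. 2.1): if
`φ : W × V → U` (hypotheses as in `rigidity`) satisfies `φ({w₀} × V) = {u₀} = φ(W × {v₀})` for
rational points `w₀, v₀` and `u₀ ∈ U(k)`, then `φ(W × V) = {u₀}`, i.e. `φ` is the constant map
`u₀`. [cite: Milne1986AbelianVarieties, §2 Thm. 2.1 (Rigidity Theorem)] -/
theorem rigidity_const {W V U : Over (Spec (.of K))}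
    [IsProper V.hom] [GeometricallyIntegral V.hom]
    [LocallyOfFiniteType W.hom] [GeometricallyIntegral W.hom]
    [IsSeparated U.hom] [LocallyOfFiniteType U.hom]
    (φ : W ⊗ V ⟶ U) (w₀ : 𝟙_ _ ⟶ W) (v₀ : 𝟙_ _ ⟶ V) (u₀ : 𝟙_ _ ⟶ U)
    (hφ : lift (toUnit V ≫ w₀) (𝟙 V) ≫ φ = toUnit V ≫ u₀)
    (hφ' : lift (𝟙 W) (toUnit W ≫ v₀) ≫ φ = toUnit W ≫ u₀) :
    φ = toUnit _ ≫ u₀ := by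
  refine (rigidity φ w₀ v₀ u₀ hφ).trans ?_
  have h : lift (fst W V) (toUnit (W ⊗ V) ≫ v₀) = fst W V ≫ lift (𝟙 W) (toUnit W ≫ v₀) := by
    rw [comp_lift, Category.comp_id, comp_toUnit_assoc]
  rw [h, Category.assoc, hφ', comp_toUnit_assoc]

/-! ### Corollaries: maps into abelian varieties (Milne AV Cor. 2.2, Cor. 2.5) -/

section Corollaries

open scoped MonObj

variable {A B : AbelianVariety K}

/-- **Milne, Abelian Varieties, Cor. 2.5** (maps from a product into an abelian variety
decompose): let `V`, `W` be geometrically integral `k`-schemes of finite type, `W` complete, with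
rational points `v₀ ∈ V(k)`, `w₀ ∈ W(k)`, and `h : V × W → A` a morphism to an abelian variety with
`h(v₀, w₀) = 0`. Then `h(v, w) = h(v, w₀) + h(v₀, w)`, i.e. `h = f ∘ p + g ∘ q` with
`f = h|V × {w₀}`, `g = h|{v₀} × W` (written multiplicatively in Mathlib's group `Hom_k(V × W, A)`).
Milne assumes both factors complete; the proof (rigidity applied to `h − f ∘ p − g ∘ q`, which
vanishes on `V × {w₀}` and on `{v₀} × W`) only uses completeness of one factor, as here.
[cite: Milne1986AbelianVarieties, §2 Cor. 2.5] -/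
theorem eq_mul_of_point_comp_eq_one {V W : Over (Spec (.of K))}
    [LocallyOfFiniteType V.hom] [GeometricallyIntegral V.hom]
    [IsProper W.hom] [GeometricallyIntegral W.hom]
    (h : V ⊗ W ⟶ A.X) (v₀ : 𝟙_ _ ⟶ V) (w₀ : 𝟙_ _ ⟶ W) (h0 : lift v₀ w₀ ≫ h = 1) :
    h = (fst V W ≫ (lift (𝟙 V) (toUnit V ≫ w₀) ≫ h)) *
      (snd V W ≫ (lift (toUnit W ≫ v₀) (𝟙 W) ≫ h)) := by
  set f := lift (𝟙 V) (toUnit V ≫ w₀) ≫ h with hf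
  set g := lift (toUnit W ≫ v₀) (𝟙 W) ≫ h with hg
  have hf0 : v₀ ≫ f = 1 := by
    rw [hf, comp_lift_assoc, Category.comp_id, ← Category.assoc, point_comp_toUnit,
      Category.id_comp, h0]
  have hg0 : w₀ ≫ g = 1 := by
    rw [hg, comp_lift_assoc, Category.comp_id, ← Category.assoc, point_comp_toUnit,
      Category.id_comp, h0]
  -- `κ(v, w) = h(v, w) · (f(v) · g(w))⁻¹` is `1` on `{v₀} × W` …
  set κ : V ⊗ W ⟶ A.X := h * ((fst V W ≫ f) * (snd V W ≫ g))⁻¹ with hκ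
  have h1 : lift (toUnit W ≫ v₀) (𝟙 W) ≫ κ = toUnit W ≫ (1 : 𝟙_ _ ⟶ A.X) := by
    rw [MonObj.comp_one, hκ, MonObj.comp_mul, GrpObj.comp_inv, MonObj.comp_mul, lift_fst_assoc,
      lift_snd_assoc, Category.id_comp, ← hg, Category.assoc, hf0, MonObj.comp_one, one_mul,
      mul_inv_cancel]
  -- … hence, by rigidity, `κ(v, w) = κ(v, w₀) = 1`.
  have h2 := rigidity κ v₀ w₀ 1 h1
  have h3 : lift (fst V W) (toUnit _ ≫ w₀) ≫ κ = 1 := by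
    have e1 : lift (fst V W) (toUnit (V ⊗ W) ≫ w₀) ≫ h = fst V W ≫ f := by
      rw [hf, comp_lift_assoc, Category.comp_id, comp_toUnit_assoc]
    rw [hκ, MonObj.comp_mul, GrpObj.comp_inv, MonObj.comp_mul, lift_fst_assoc, lift_snd_assoc,
      e1, Category.assoc, hg0, MonObj.comp_one, mul_one, mul_inv_cancel]
  rw [h3] at h2
  rw [hκ] at h2
  exact mul_inv_eq_one.mp h2

/-- **Milne, Abelian Varieties, Cor. 2.2** (a morphism of abelian varieties preserving the origin
is a homomorphism): for abelian varieties `A`, `B` over `k` and a `k`-morphism `f : A → B` with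
`f(0) = 0`, `f(a + a') = f(a) + f(a')`, i.e. `f` is a homomorphism of group schemes. Proof as
printed: rigidity applied to `(a, a') ↦ f(a + a') − f(a) − f(a')`, which vanishes on `A × {0}`
and `{0} × A`. [cite: Milne1986AbelianVarieties, §2 Cor. 2.2] -/
theorem isMonHom_of_one_comp (f : A.X ⟶ B.X) (hf : η[A.X] ≫ f = η[B.X]) : IsMonHom f := by
  have hf1 : (1 : 𝟙_ _ ⟶ A.X) ≫ f = 1 := by
    rw [← MonObj.one_eq_one A.X, ← MonObj.one_eq_one B.X, hf]
  -- `φ(a, a') = f(a·a')`, with `φ(e, e) = e`; decompose it by Cor. 2.5.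
  have key := eq_mul_of_point_comp_eq_one (A := B) ((fst A.X A.X * snd A.X A.X) ≫ f) 1 1 (by
    rw [← Category.assoc, MonObj.comp_mul, lift_fst, lift_snd, mul_one, hf1])
  have e1 : lift (𝟙 A.X) (toUnit A.X ≫ (1 : 𝟙_ _ ⟶ A.X)) ≫ (fst A.X A.X * snd A.X A.X) ≫ f = f := by
    rw [← Category.assoc, MonObj.comp_mul, lift_fst, lift_snd, MonObj.comp_one, mul_one,
      Category.id_comp]
  have e2 : lift (toUnit A.X ≫ (1 : 𝟙_ _ ⟶ A.X)) (𝟙 A.X) ≫ (fst A.X A.X * snd A.X A.X) ≫ f = f := by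
    rw [← Category.assoc, MonObj.comp_mul, lift_fst, lift_snd, MonObj.comp_one, one_mul,
      Category.id_comp]
  rw [e1, e2] at key
  refine ⟨hf, ?_⟩
  rw [MonObj.mul_eq_mul A.X, key, MonObj.mul_eq_mul B.X, MonObj.comp_mul, tensorHom_fst,
    tensorHom_snd]

end Corollaries

end Literature.AlgebraicGeometry.Motives
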